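import Summits.HodgeConjecture.HodgeConjecture.Theorems.AnchorTransportAnchorExistenceQbarFibreMechanism
import Summits.HodgeConjecture.HodgeConjecture.Theorems.QbarEnvelopeEnvelopeStubNumberFieldModel
import Summits.HodgeConjecture.HodgeConjecture.Theorems.LinearSystemTorelliMiddleDivisorSupportFourfoldOfPeriodDeficiency
import Summits.HodgeConjecture.HodgeConjecture.Theorems.LinearSystemTorelliMiddleDivisorSupportFourfoldStubFiniteMonodromyOfTypeStability
import Literature.AlgebraicGeometry.HodgeTheory.AlgebraicCyclesDefinedOverQbarSpread
import Literature.AlgebraicGeometry.HodgeTheory.ContinuationLoopsZariskiOpen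
import HarnessLib

/-!
# Route `AnchorTransport` — crux `AnchorExistence` (stmt-HodgeConjecture-1077), line `qbar-fibre-anchors`:
# `ℚ̄`-fibre anchors for ALL Hodge pairs from the transcendence kernel, hence stub 4 (part B)

Helper file for the crux item stmt-HodgeConjecture-1077 (`--supports`; it closes nothing), line
`qbar-fibre-anchors` (`Cruxes/AnchorExistence/Lines/qbar_fibre_anchors.lean`, lead c5), registered
sub-goal `qbarFibreAnchors_of_typeStability_of_riemannExistence_of_globalInvariantCycles`.  It assembles
part A (`AnchorTransportAnchorExistenceQbarFibreMechanism`: the FAMILY form of Voisin's `ℚ̄`-mechanism,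
`qbarFibreFamily_of_finiteMonodromy`, from the named facts (C) `FundamentalGroup.riemannExistence_qbarDescent_of_finiteIndex`
and (D) `deligne_globalInvariantCycles`), the spreading-out theorem
(`spreadingOut_smoothProjective_qbarFamily_holds`, PROVED), the number-field models of smooth projective
`ℚ̄`-schemes (`stub_numberFieldModel`, p145483, PROVED) and ONE transcendence input into:

> **`ℚ̄`-fibre anchors**: every rational `(p,p)` class `c` on a smooth projective complex `X` is carried by
> a Hodge datum — a smooth projective family over a smooth irreducible `ℂ`-base with a global class
> fibrewise rational of type `(p,p)` restricting to `c` through `e : X ≅ 𝒳_{s₁}` — one of whose fibres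
> is DEFINABLE OVER A NUMBER FIELD,

i.e. the hypothesis-free body of the lead's `QbarFibreAnchorAt` for EVERY pair (so, by the skeleton's
`qbarFibreAnchors_iff_stubs`, stubs 2 ∧ 3 ∧ 4 of the line at once, and `HCOverNumberFields → AnchorExistence`
by the registered glue `anchorExistence_of_hcOverNumberFields_of_qbarFibreAnchors`).  The transcendence
input is either (T) TYPE STABILITY AT `ℚ̄`-GENERIC POINTS, Zariski-locally on the base — verbatim the
registered kernel `stub_typeStabilityAtQbarGenericZariskiLocal` of the sibling crux stmt-1069
(`Cruxes/Envelope/Lines/birth.lean`; Voisin 2007 Thm. 0.5 (2), KOU 2023 Thm. 1.12; OPEN), which gives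
finite monodromy at the `ℚ̄`-generic spread point by loop shrinking
(`IsContinuationAlong.exists_loop_forall_base_pt_notMem_of_qbarFamily`) and Hodge–Riemann
(`linearSystemTorelli_finite_setOf_isContinuationAlong_of_forall_isOfHodgeType`), both PROVED — or (T')
`PeriodDeficiency.ClassicalGeometricVHS` (stmt-11597) ∧ `PeriodDeficiency.QbarGenericIsHodgeGeneric`
(stmt-11595, KOU Conj. 1.5 (a)) ∧ the named fact `bku_finite_monodromyOrbit_of_isHodgeGenericIn`
(`linearSystemTorelli_finiteMonodromyAtGenericSpread_of_qbarGenericIsHodgeGeneric`).  The transcendence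
hypothesis is only ever used at the SAME `(n, p)` as the pair (pointwise theorems `…At`), so the crux
composition may assume it in the middle range only.

* `qbarFibreAnchorAt_of_spread_of_finite` — one `ℚ̄`-spread with finite orbit ⟹ a `ℚ̄`-fibre anchor;
* `qbarFibreAnchorAt_of_finiteMonodromyAt`, `finiteMonodromyAt_of_typeStabilityAt`,
  `qbarFibreAnchorAt_of_typeStabilityAt` — pointwise in `(n, p)`, `hN`-parametrised;
* `qbarFibreAnchors_of_typeStability_of_riemannExistence_of_globalInvariantCycles` — (T) → (C) → (D) →
  `ℚ̄`-fibre anchors for all pairs (N discharged by `stub_numberFieldModel`): the registered sub-goal;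
* `qbarFibreAnchors_of_qbarGenericIsHodgeGeneric'` — the same from (T') + (C) + (D);
* `stub_qbarFibreAnchor_of_pairMovable_of_typeStability`, `…_of_qbarGenericIsHodgeGeneric` — the
  registered signature of STUB 4, verbatim, from (T) resp. (T') + (C) + (D) (pair-movability unused).
-/

-- every declaration of this problem lives in `Summit.HodgeConjecture.HodgeConjecture.…`
set_option linter.dupNamespace false

noncomputable section

open CategoryTheory AlgebraicGeometry
open Literature.AlgebraicGeometry Literature.AlgebraicGeometry.Motives
  Literature.AlgebraicGeometry.HodgeTheory Literature.AlgebraicTopology.SingularHomology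
open Summit.HodgeConjecture.HodgeConjecture.Theses.AnchorTransport
open Summit.HodgeConjecture.HodgeConjecture.Theorems

namespace Summit.HodgeConjecture.HodgeConjecture.Theorems.QbarFibreAnchors

section Pointwise

open scoped Topology

variable {n p : ℕ}

/-- **A `ℚ̄`-fibre anchor from ONE `ℚ̄`-spread with finite monodromy**: given `σ`, a `ℚ̄`-spread
`e : X ≅ 𝒳_s` of `X` as a fibre of the complexification of a `ℚ̄`-family `f₀` over a smooth irreducible
quasi-projective base, and finiteness of the monodromy orbit of `(e⁻¹)^* c`, the mechanism
`qbarFibreFamily_of_finiteMonodromy` ((C), (D)) and number-field models of smooth projective `ℚ̄`-schemes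
(`hN`) give a Hodge datum through `(X, c)` with a fibre definable over a number field.
[cite: Voisin2007HodgeLoci, §3, proof of Prop. 0.7] [cite: CharlesSchnell2014Notes, Thm. 11.3.19] -/
theorem qbarFibreAnchorAt_of_spread_of_finite
    (hRE : Literature.AlgebraicGeometry.FundamentalGroup.riemannExistence_qbarDescent_of_finiteIndex)
    (hD : deligne_globalInvariantCycles)
    (hN : ∀ ⦃m : ℕ⦄ (W₀ : SchemeOver (AlgebraicClosure ℚ)), IsSmoothProjective m W₀ →
      ∃ (K : Type) (_ : Field K) (_ : NumberField K) (ι : K →+* AlgebraicClosure ℚ)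
        (W₁ : SchemeOver K), Nonempty (W₀ ≅ (baseChangeHom ι).obj W₁))
    (σ : AlgebraicClosure ℚ →+* ℂ) {X : SchemeOver ℂ} (c : complexBetti X (2 * p))
    (hc : IsRationalClass c) (hpp : IsOfHodgeType n X (2 * p) p p c)
    {𝒳₀ S₀ : SchemeOver (AlgebraicClosure ℚ)} (f₀ : 𝒳₀ ⟶ S₀)
    (s : ComplexPoints ((baseChangeHom σ).obj S₀)) (e : X ≅ fiberOver ((baseChangeHom σ).map f₀) s)
    (h𝒳₀ : IsQuasiProjectiveOver 𝒳₀) (hS₀ : IsQuasiProjectiveOver S₀) (hirr : IrreducibleSpace S₀.left)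
    (hsm : AlgebraicGeometry.Smooth S₀.hom) (hf : IsSmoothProjectiveFamily ((baseChangeHom σ).map f₀) n)
    (hfin : {β : complexBetti (fiberOver ((baseChangeHom σ).map f₀) s) (2 * p) |
        ∃ γ : Path s s, IsContinuationAlong γ (complexBetti.map e.inv (2 * p) c) β}.Finite) :
    ∃ (𝒳 S : SchemeOver ℂ) (f : 𝒳 ⟶ S) (s₁ s₀ : ComplexPoints S) (e : X ≅ fiberOver f s₁)
      (A : complexBetti 𝒳 (2 * p)),
      IsSmoothProjectiveFamily f n ∧ IrreducibleSpace S.left ∧ AlgebraicGeometry.Smooth S.hom ∧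
      (∀ s : ComplexPoints S, IsRationalClass (complexBetti.map (fiberι f s) (2 * p) A) ∧
        IsOfHodgeType n (fiberOver f s) (2 * p) p p (complexBetti.map (fiberι f s) (2 * p) A)) ∧
      complexBetti.map e.hom (2 * p) (complexBetti.map (fiberι f s₁) (2 * p) A) = c ∧
      ∃ (K : Type) (_ : Field K) (_ : NumberField K) (σ : K →+* ℂ) (X₀ : SchemeOver K),
        Nonempty (fiberOver f s₀ ≅ (baseChangeHom σ).obj X₀) := by
  obtain ⟨𝒳', S', f', s', s₀, e', A, Y₀, hf', hirr', hsm', hfib, hA, ⟨eY⟩⟩ :=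
    qbarFibreFamily_of_finiteMonodromy hRE hD σ f₀ n p h𝒳₀ hS₀ hirr hsm hf s _ (hc.map _)
      (hpp.map_of_iso e.symm) hfin
  -- the `ℚ̄`-fibre is smooth projective over `ℚ̄` (descent), hence has a number-field model
  have hY : IsSmoothProjective n ((baseChangeHom σ).obj Y₀) := (hf'.isSmoothProjective s₀).of_iso eY
  obtain ⟨K, hK, hKn, ι, X₁, ⟨e₁⟩⟩ := hN Y₀ (isSmoothProjective_of_baseChangeHom σ Y₀ hY)
  obtain ⟨e₂⟩ := iso_baseChangeHom_comp_of_rigid ι σ X₁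
  refine ⟨𝒳', S', f', s', s₀, e ≪≫ e', A, hf', hirr', hsm', hfib, ?_,
    K, hK, hKn, σ.comp ι, X₁, ⟨eY ≪≫ (baseChangeHom σ).mapIso e₁ ≪≫ e₂⟩⟩
  -- `(e ≫ e')^* (A|_{s'}) = e^* (e'^* (A|_{s'})) = e^* ((e⁻¹)^* c) = c`
  rw [Iso.trans_hom, complexBetti.map_comp, CategoryTheory.comp_apply, hA]
  exact e.complexBetti_map_hom_map_inv (2 * p) c

/-- **`ℚ̄`-fibre anchor at `(X, c)` ⟸ finite monodromy at `ℚ̄`-generic spreads IN THE SAME `(n, p)`**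
(+ (C), (D), `hN`): spread `X` out over `ℚ̄` (`spreadingOut_smoothProjective_qbarFamily_holds`, PROVED;
`s` over the generic point) and apply `qbarFibreAnchorAt_of_spread_of_finite`.
[cite: CharlesSchnell2014Notes, §11.3.5 and Thm. 11.3.19] [cite: Voisin2007HodgeLoci, §3, proof of Prop. 0.7] -/
theorem qbarFibreAnchorAt_of_finiteMonodromyAt
    (hFM : ∀ (σ : AlgebraicClosure ℚ →+* ℂ) ⦃𝒳₀ S₀ : SchemeOver (AlgebraicClosure ℚ)⦄ (f₀ : 𝒳₀ ⟶ S₀),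
      IsQuasiProjectiveOver 𝒳₀ → IsQuasiProjectiveOver S₀ → IrreducibleSpace S₀.left →
      AlgebraicGeometry.Smooth S₀.hom → IsSmoothProjectiveFamily ((baseChangeHom σ).map f₀) n →
      ∀ (s : ComplexPoints ((baseChangeHom σ).obj S₀)),
        closure {(baseChangeHomFst σ S₀).base s.pt} = (Set.univ : Set S₀.left) →
        ∀ (α : complexBetti (fiberOver ((baseChangeHom σ).map f₀) s) (2 * p)),
          IsRationalClass α → IsOfHodgeType n (fiberOver ((baseChangeHom σ).map f₀) s) (2 * p) p p α →
          {β : complexBetti (fiberOver ((baseChangeHom σ).map f₀) s) (2 * p) |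
              ∃ γ : Path s s, IsContinuationAlong γ α β}.Finite)
    (hRE : Literature.AlgebraicGeometry.FundamentalGroup.riemannExistence_qbarDescent_of_finiteIndex)
    (hD : deligne_globalInvariantCycles)
    (hN : ∀ ⦃m : ℕ⦄ (W₀ : SchemeOver (AlgebraicClosure ℚ)), IsSmoothProjective m W₀ →
      ∃ (K : Type) (_ : Field K) (_ : NumberField K) (ι : K →+* AlgebraicClosure ℚ)
        (W₁ : SchemeOver K), Nonempty (W₀ ≅ (baseChangeHom ι).obj W₁))
    {X : SchemeOver ℂ} (hX : IsSmoothProjective n X) (c : complexBetti X (2 * p))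
    (hc : IsRationalClass c) (hpp : IsOfHodgeType n X (2 * p) p p c) :
    ∃ (𝒳 S : SchemeOver ℂ) (f : 𝒳 ⟶ S) (s₁ s₀ : ComplexPoints S) (e : X ≅ fiberOver f s₁)
      (A : complexBetti 𝒳 (2 * p)),
      IsSmoothProjectiveFamily f n ∧ IrreducibleSpace S.left ∧ AlgebraicGeometry.Smooth S.hom ∧
      (∀ s : ComplexPoints S, IsRationalClass (complexBetti.map (fiberι f s) (2 * p) A) ∧
        IsOfHodgeType n (fiberOver f s) (2 * p) p p (complexBetti.map (fiberι f s) (2 * p) A)) ∧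
      complexBetti.map e.hom (2 * p) (complexBetti.map (fiberι f s₁) (2 * p) A) = c ∧
      ∃ (K : Type) (_ : Field K) (_ : NumberField K) (σ : K →+* ℂ) (X₀ : SchemeOver K),
        Nonempty (fiberOver f s₀ ≅ (baseChangeHom σ).obj X₀) := by
  obtain ⟨σ⟩ := exists_ringHom_algebraicClosure_rat_complex
  -- spread `X` out over `ℚ̄`: `e : X ≅ 𝒳_s`, `s` over the generic point of the smooth irreducible `S₀`
  obtain ⟨𝒳₀, S₀, f₀, s, h𝒳₀, hS₀, hirr, hsm, hf, hgen, ⟨e⟩⟩ :=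
    spreadingOut_smoothProjective_qbarFamily_holds σ hX
  exact qbarFibreAnchorAt_of_spread_of_finite hRE hD hN σ c hc hpp f₀ s e h𝒳₀ hS₀ hirr hsm hf
    (hFM σ f₀ h𝒳₀ hS₀ hirr hsm hf s hgen _ (hc.map _) (hpp.map_of_iso e.symm))

-- adapted from `Cruxes/Envelope/Lines/birth.lean` (`typeStabilityAtQbarGeneric_of_zariskiLocal`)
/-- **Finite monodromy at `ℚ̄`-generic points ⟸ type stability Zariski-locally there, in the same
`(n, p)`** (loop shrinking `IsContinuationAlong.exists_loop_forall_base_pt_notMem_of_qbarFamily`, p136872,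
+ Hodge–Riemann / lattice finiteness `linearSystemTorelli_finite_setOf_isContinuationAlong_of_forall_isOfHodgeType`,
both PROVED). [cite: CattaniDeligneKaplan1995JAMS, §1] [cite: Voisin2007HodgeLoci, Thm. 0.5 (2)] -/
theorem finiteMonodromyAt_of_typeStabilityAt
    (hT : ∀ (σ : AlgebraicClosure ℚ →+* ℂ) ⦃𝒳₀ S₀ : SchemeOver (AlgebraicClosure ℚ)⦄ (f₀ : 𝒳₀ ⟶ S₀),
      IsQuasiProjectiveOver 𝒳₀ → IsQuasiProjectiveOver S₀ → IrreducibleSpace S₀.left →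
      AlgebraicGeometry.Smooth S₀.hom → IsSmoothProjectiveFamily ((baseChangeHom σ).map f₀) n →
      ∀ (s : ComplexPoints ((baseChangeHom σ).obj S₀)),
        closure {(baseChangeHomFst σ S₀).base s.pt} = (Set.univ : Set S₀.left) →
        ∀ (α : complexBetti (fiberOver ((baseChangeHom σ).map f₀) s) (2 * p)),
          IsRationalClass α → IsOfHodgeType n (fiberOver ((baseChangeHom σ).map f₀) s) (2 * p) p p α →
          ∃ Z₀ : Set S₀.left, IsClosed Z₀ ∧ Z₀ ≠ Set.univ ∧
            ∀ (γ : Path s s), (∀ u, (baseChangeHomFst σ S₀).base (γ u).pt ∉ Z₀) →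
              ∀ (β : complexBetti (fiberOver ((baseChangeHom σ).map f₀) s) (2 * p)),
                IsContinuationAlong γ α β →
                  IsOfHodgeType n (fiberOver ((baseChangeHom σ).map f₀) s) (2 * p) p p β) :
    ∀ (σ : AlgebraicClosure ℚ →+* ℂ) ⦃𝒳₀ S₀ : SchemeOver (AlgebraicClosure ℚ)⦄ (f₀ : 𝒳₀ ⟶ S₀),
      IsQuasiProjectiveOver 𝒳₀ → IsQuasiProjectiveOver S₀ → IrreducibleSpace S₀.left →
      AlgebraicGeometry.Smooth S₀.hom → IsSmoothProjectiveFamily ((baseChangeHom σ).map f₀) n →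
      ∀ (s : ComplexPoints ((baseChangeHom σ).obj S₀)),
        closure {(baseChangeHomFst σ S₀).base s.pt} = (Set.univ : Set S₀.left) →
        ∀ (α : complexBetti (fiberOver ((baseChangeHom σ).map f₀) s) (2 * p)),
          IsRationalClass α → IsOfHodgeType n (fiberOver ((baseChangeHom σ).map f₀) s) (2 * p) p p α →
          {β : complexBetti (fiberOver ((baseChangeHom σ).map f₀) s) (2 * p) |
              ∃ γ : Path s s, IsContinuationAlong γ α β}.Finite := by
  intro σ 𝒳₀ S₀ f₀ h𝒳₀ hS₀ hirr hsm hf s hgen α hα hh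
  refine linearSystemTorelli_finite_setOf_isContinuationAlong_of_forall_isOfHodgeType σ f₀ n p hf h𝒳₀
    hS₀ hirr hsm s α hα fun γ β hγ ↦ ?_
  obtain ⟨Z₀, hZ₀, hZ₀', H⟩ := hT σ f₀ h𝒳₀ hS₀ hirr hsm hf s hgen α hα hh
  haveI := hirr
  haveI := hsm
  obtain ⟨γ', hγ', hc⟩ :=
    IsContinuationAlong.exists_loop_forall_base_pt_notMem_of_qbarFamily σ f₀ (2 * p) hS₀ hf hZ₀ hZ₀'
      hgen hγ
  exact H γ' hγ' β hc

/-- **`ℚ̄`-fibre anchor at `(X, c)` ⟸ type stability at `ℚ̄`-generic points IN THE SAME `(n, p)`**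
(+ (C), (D), `hN`) — so the crux composition may assume the transcendence kernel in the middle range
`2 ≤ p ≤ n - 2` only. [cite: Voisin2007HodgeLoci, Thm. 0.5 (2) and §3, proof of Prop. 0.7]
[cite: CharlesSchnell2014Notes, Thm. 11.3.19] -/
theorem qbarFibreAnchorAt_of_typeStabilityAt
    (hT : ∀ (σ : AlgebraicClosure ℚ →+* ℂ) ⦃𝒳₀ S₀ : SchemeOver (AlgebraicClosure ℚ)⦄ (f₀ : 𝒳₀ ⟶ S₀),
      IsQuasiProjectiveOver 𝒳₀ → IsQuasiProjectiveOver S₀ → IrreducibleSpace S₀.left →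
      AlgebraicGeometry.Smooth S₀.hom → IsSmoothProjectiveFamily ((baseChangeHom σ).map f₀) n →
      ∀ (s : ComplexPoints ((baseChangeHom σ).obj S₀)),
        closure {(baseChangeHomFst σ S₀).base s.pt} = (Set.univ : Set S₀.left) →
        ∀ (α : complexBetti (fiberOver ((baseChangeHom σ).map f₀) s) (2 * p)),
          IsRationalClass α → IsOfHodgeType n (fiberOver ((baseChangeHom σ).map f₀) s) (2 * p) p p α →
          ∃ Z₀ : Set S₀.left, IsClosed Z₀ ∧ Z₀ ≠ Set.univ ∧
            ∀ (γ : Path s s), (∀ u, (baseChangeHomFst σ S₀).base (γ u).pt ∉ Z₀) →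
              ∀ (β : complexBetti (fiberOver ((baseChangeHom σ).map f₀) s) (2 * p)),
                IsContinuationAlong γ α β →
                  IsOfHodgeType n (fiberOver ((baseChangeHom σ).map f₀) s) (2 * p) p p β)
    (hRE : Literature.AlgebraicGeometry.FundamentalGroup.riemannExistence_qbarDescent_of_finiteIndex)
    (hD : deligne_globalInvariantCycles)
    (hN : ∀ ⦃m : ℕ⦄ (W₀ : SchemeOver (AlgebraicClosure ℚ)), IsSmoothProjective m W₀ →
      ∃ (K : Type) (_ : Field K) (_ : NumberField K) (ι : K →+* AlgebraicClosure ℚ)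
        (W₁ : SchemeOver K), Nonempty (W₀ ≅ (baseChangeHom ι).obj W₁))
    {X : SchemeOver ℂ} (hX : IsSmoothProjective n X) (c : complexBetti X (2 * p))
    (hc : IsRationalClass c) (hpp : IsOfHodgeType n X (2 * p) p p c) :
    ∃ (𝒳 S : SchemeOver ℂ) (f : 𝒳 ⟶ S) (s₁ s₀ : ComplexPoints S) (e : X ≅ fiberOver f s₁)
      (A : complexBetti 𝒳 (2 * p)),
      IsSmoothProjectiveFamily f n ∧ IrreducibleSpace S.left ∧ AlgebraicGeometry.Smooth S.hom ∧
      (∀ s : ComplexPoints S, IsRationalClass (complexBetti.map (fiberι f s) (2 * p) A) ∧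
        IsOfHodgeType n (fiberOver f s) (2 * p) p p (complexBetti.map (fiberι f s) (2 * p) A)) ∧
      complexBetti.map e.hom (2 * p) (complexBetti.map (fiberι f s₁) (2 * p) A) = c ∧
      ∃ (K : Type) (_ : Field K) (_ : NumberField K) (σ : K →+* ℂ) (X₀ : SchemeOver K),
        Nonempty (fiberOver f s₀ ≅ (baseChangeHom σ).obj X₀) :=
  qbarFibreAnchorAt_of_finiteMonodromyAt (finiteMonodromyAt_of_typeStabilityAt hT) hRE hD hN hX c hc hpp

end Pointwise

/-! ### `ℚ̄`-fibre anchors for ALL pairs (N discharged by `stub_numberFieldModel`) and stub 4 verbatim -/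

/-- **`ℚ̄`-FIBRE ANCHORS FOR ALL PAIRS ⟸ (T) + (C) + (D)** (registered sub-goal of stmt-1077): every
rational `(p,p)` class on a smooth projective complex variety is carried by a Hodge datum with a fibre
definable over a number field, granted (T) type stability Zariski-locally at `ℚ̄`-generic points (=
stmt-1069's registered `stub_typeStabilityAtQbarGenericZariskiLocal`, OPEN), (C) the named fact
`FundamentalGroup.riemannExistence_qbarDescent_of_finiteIndex`, (D) the named fact
`deligne_globalInvariantCycles`; number-field descent (N) is the tree's `stub_numberFieldModel` (p145483).
[cite: Voisin2007HodgeLoci, Thm. 0.5 (2) and §3, proof of Prop. 0.7] [cite: CharlesSchnell2014Notes, Thm. 11.3.19]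
[cite: KlinglerOtwinowskaUrbanik2023, Thm. 1.12] -/
theorem qbarFibreAnchors_of_typeStability_of_riemannExistence_of_globalInvariantCycles :
    (∀ (σ : AlgebraicClosure ℚ →+* ℂ) ⦃𝒳₀ S₀ : SchemeOver (AlgebraicClosure ℚ)⦄ (f₀ : 𝒳₀ ⟶ S₀)
      (n p : ℕ), IsQuasiProjectiveOver 𝒳₀ → IsQuasiProjectiveOver S₀ → IrreducibleSpace S₀.left →
      AlgebraicGeometry.Smooth S₀.hom → IsSmoothProjectiveFamily ((baseChangeHom σ).map f₀) n →
      ∀ (s : ComplexPoints ((baseChangeHom σ).obj S₀)),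
        closure {(baseChangeHomFst σ S₀).base s.pt} = (Set.univ : Set S₀.left) →
        ∀ (α : complexBetti (fiberOver ((baseChangeHom σ).map f₀) s) (2 * p)),
          IsRationalClass α → IsOfHodgeType n (fiberOver ((baseChangeHom σ).map f₀) s) (2 * p) p p α →
          ∃ Z₀ : Set S₀.left, IsClosed Z₀ ∧ Z₀ ≠ Set.univ ∧
            ∀ (γ : Path s s), (∀ u, (baseChangeHomFst σ S₀).base (γ u).pt ∉ Z₀) →
              ∀ (β : complexBetti (fiberOver ((baseChangeHom σ).map f₀) s) (2 * p)),
                IsContinuationAlong γ α β →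
                  IsOfHodgeType n (fiberOver ((baseChangeHom σ).map f₀) s) (2 * p) p p β) →
    Literature.AlgebraicGeometry.FundamentalGroup.riemannExistence_qbarDescent_of_finiteIndex →
    Literature.AlgebraicGeometry.HodgeTheory.deligne_globalInvariantCycles →
    ∀ ⦃n : ℕ⦄ ⦃X : SchemeOver ℂ⦄, IsSmoothProjective n X →
      ∀ (p : ℕ) (c : complexBetti X (2 * p)), IsRationalClass c → IsOfHodgeType n X (2 * p) p p c →
      ∃ (𝒳 S : SchemeOver ℂ) (f : 𝒳 ⟶ S) (s₁ s₀ : ComplexPoints S) (e : X ≅ fiberOver f s₁)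
        (A : complexBetti 𝒳 (2 * p)),
        IsSmoothProjectiveFamily f n ∧ IrreducibleSpace S.left ∧ AlgebraicGeometry.Smooth S.hom ∧
        (∀ s : ComplexPoints S, IsRationalClass (complexBetti.map (fiberι f s) (2 * p) A) ∧
          IsOfHodgeType n (fiberOver f s) (2 * p) p p (complexBetti.map (fiberι f s) (2 * p) A)) ∧
        complexBetti.map e.hom (2 * p) (complexBetti.map (fiberι f s₁) (2 * p) A) = c ∧
        ∃ (K : Type) (_ : Field K) (_ : NumberField K) (σ : K →+* ℂ) (X₀ : SchemeOver K),
          Nonempty (fiberOver f s₀ ≅ (baseChangeHom σ).obj X₀) :=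
  fun hT hRE hD n _ hX p c hc hpp ↦
    qbarFibreAnchorAt_of_typeStabilityAt (fun σ _ _ f₀ ↦ hT σ f₀ n p) hRE hD stub_numberFieldModel hX c
      hc hpp

/-- **`ℚ̄`-FIBRE ANCHORS FOR ALL PAIRS ⟸ (T') + (C) + (D)** — the alternative transcendence input of
route `PeriodDeficiency`: `ClassicalGeometricVHS` (stmt-11597) ∧ `QbarGenericIsHodgeGeneric` (stmt-11595,
a `ℚ̄`-generic point is Hodge generic, KOU Conj. 1.5 (a), OPEN) ∧ the named fact
`bku_finite_monodromyOrbit_of_isHodgeGenericIn`; the tree's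
`linearSystemTorelli_finiteMonodromyAtGenericSpread_of_qbarGenericIsHodgeGeneric` (all `(n,p)`) supplies
the spread together with the finite orbit; N is `stub_numberFieldModel`.
[cite: KlinglerOtwinowskaUrbanik2023, Conj. 1.5 (a) and Thm. 1.12] [cite: BaldiKlinglerUllmo2024, §3.2]
[cite: CharlesSchnell2014Notes, Thm. 11.3.19] -/
theorem qbarFibreAnchors_of_qbarGenericIsHodgeGeneric'
    (hC : Summit.HodgeConjecture.HodgeConjecture.Theses.PeriodDeficiency.ClassicalGeometricVHS)
    (hG : Summit.HodgeConjecture.HodgeConjecture.Theses.PeriodDeficiency.QbarGenericIsHodgeGeneric)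
    (hB : bku_finite_monodromyOrbit_of_isHodgeGenericIn)
    (hRE : Literature.AlgebraicGeometry.FundamentalGroup.riemannExistence_qbarDescent_of_finiteIndex)
    (hD : deligne_globalInvariantCycles) :
    ∀ ⦃n : ℕ⦄ ⦃X : SchemeOver ℂ⦄, IsSmoothProjective n X →
      ∀ (p : ℕ) (c : complexBetti X (2 * p)), IsRationalClass c → IsOfHodgeType n X (2 * p) p p c →
      ∃ (𝒳 S : SchemeOver ℂ) (f : 𝒳 ⟶ S) (s₁ s₀ : ComplexPoints S) (e : X ≅ fiberOver f s₁)
        (A : complexBetti 𝒳 (2 * p)),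
        IsSmoothProjectiveFamily f n ∧ IrreducibleSpace S.left ∧ AlgebraicGeometry.Smooth S.hom ∧
        (∀ s : ComplexPoints S, IsRationalClass (complexBetti.map (fiberι f s) (2 * p) A) ∧
          IsOfHodgeType n (fiberOver f s) (2 * p) p p (complexBetti.map (fiberι f s) (2 * p) A)) ∧
        complexBetti.map e.hom (2 * p) (complexBetti.map (fiberι f s₁) (2 * p) A) = c ∧
        ∃ (K : Type) (_ : Field K) (_ : NumberField K) (σ : K →+* ℂ) (X₀ : SchemeOver K),
          Nonempty (fiberOver f s₀ ≅ (baseChangeHom σ).obj X₀) := by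
  intro n X hX p c hc hpp
  obtain ⟨σ⟩ := exists_ringHom_algebraicClosure_rat_complex
  obtain ⟨𝒳₀, S₀, f₀, s, e, h𝒳₀, hS₀, hirr, hsm, hf, -, hfin⟩ :=
    linearSystemTorelli_finiteMonodromyAtGenericSpread_of_qbarGenericIsHodgeGeneric hC hG hB σ hX p c
      hc hpp
  exact qbarFibreAnchorAt_of_spread_of_finite hRE hD stub_numberFieldModel σ c hc hpp f₀ s e h𝒳₀ hS₀
    hirr hsm hf hfin

/-- **STUB 4 ⟸ (T) + (C) + (D)** — the registered signature of `stub_qbarFibreAnchor_of_pairMovable`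
(`Cruxes/AnchorExistence/Lines/qbar_fibre_anchors.lean`), VERBATIM, from (T) type stability
Zariski-locally at `ℚ̄`-generic points (stmt-1069's kernel, OPEN), (C)
`FundamentalGroup.riemannExistence_qbarDescent_of_finiteIndex` and (D) `deligne_globalInvariantCycles`
(named facts).  The pair-movability hypothesis is discarded: (T) + (C) + (D) anchor EVERY Hodge pair.
[cite: Voisin2007HodgeLoci, Thm. 0.5 (2) and §3, proof of Prop. 0.7] [cite: CharlesSchnell2014Notes, Thm. 11.3.19] -/
theorem stub_qbarFibreAnchor_of_pairMovable_of_typeStability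
    (hT : ∀ (σ : AlgebraicClosure ℚ →+* ℂ) ⦃𝒳₀ S₀ : SchemeOver (AlgebraicClosure ℚ)⦄ (f₀ : 𝒳₀ ⟶ S₀)
      (n p : ℕ), IsQuasiProjectiveOver 𝒳₀ → IsQuasiProjectiveOver S₀ → IrreducibleSpace S₀.left →
      AlgebraicGeometry.Smooth S₀.hom → IsSmoothProjectiveFamily ((baseChangeHom σ).map f₀) n →
      ∀ (s : ComplexPoints ((baseChangeHom σ).obj S₀)),
        closure {(baseChangeHomFst σ S₀).base s.pt} = (Set.univ : Set S₀.left) →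
        ∀ (α : complexBetti (fiberOver ((baseChangeHom σ).map f₀) s) (2 * p)),
          IsRationalClass α → IsOfHodgeType n (fiberOver ((baseChangeHom σ).map f₀) s) (2 * p) p p α →
          ∃ Z₀ : Set S₀.left, IsClosed Z₀ ∧ Z₀ ≠ Set.univ ∧
            ∀ (γ : Path s s), (∀ u, (baseChangeHomFst σ S₀).base (γ u).pt ∉ Z₀) →
              ∀ (β : complexBetti (fiberOver ((baseChangeHom σ).map f₀) s) (2 * p)),
                IsContinuationAlong γ α β →
                  IsOfHodgeType n (fiberOver ((baseChangeHom σ).map f₀) s) (2 * p) p p β)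
    (hRE : Literature.AlgebraicGeometry.FundamentalGroup.riemannExistence_qbarDescent_of_finiteIndex)
    (hD : deligne_globalInvariantCycles) :
    ∀ ⦃n : ℕ⦄ ⦃X : SchemeOver ℂ⦄, IsSmoothProjective n X →
      ∀ (p : ℕ) (c : complexBetti X (2 * p)), IsRationalClass c → IsOfHodgeType n X (2 * p) p p c →
      ¬ (∀ ⦃𝒳 S : SchemeOver ℂ⦄ (f : 𝒳 ⟶ S) (s₁ s₀ : ComplexPoints S) (e : X ≅ fiberOver f s₁)
          (A : complexBetti 𝒳 (2 * p)),
        IsSmoothProjectiveFamily f n → IrreducibleSpace S.left → AlgebraicGeometry.Smooth S.hom →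
        (∀ s : ComplexPoints S, IsRationalClass (complexBetti.map (fiberι f s) (2 * p) A) ∧
          IsOfHodgeType n (fiberOver f s) (2 * p) p p (complexBetti.map (fiberι f s) (2 * p) A)) →
        complexBetti.map e.hom (2 * p) (complexBetti.map (fiberι f s₁) (2 * p) A) = c →
        Nonempty (X ≅ fiberOver f s₀)) →
      ∃ (𝒳 S : SchemeOver ℂ) (f : 𝒳 ⟶ S) (s₁ s₀ : ComplexPoints S) (e : X ≅ fiberOver f s₁)
        (A : complexBetti 𝒳 (2 * p)),
        IsSmoothProjectiveFamily f n ∧ IrreducibleSpace S.left ∧ AlgebraicGeometry.Smooth S.hom ∧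
        (∀ s : ComplexPoints S, IsRationalClass (complexBetti.map (fiberι f s) (2 * p) A) ∧
          IsOfHodgeType n (fiberOver f s) (2 * p) p p (complexBetti.map (fiberι f s) (2 * p) A)) ∧
        complexBetti.map e.hom (2 * p) (complexBetti.map (fiberι f s₁) (2 * p) A) = c ∧
        ∃ (K : Type) (_ : Field K) (_ : NumberField K) (σ : K →+* ℂ) (X₀ : SchemeOver K),
          Nonempty (fiberOver f s₀ ≅ (baseChangeHom σ).obj X₀) :=
  fun _ _ hX p c hc hpp _ ↦
    qbarFibreAnchors_of_typeStability_of_riemannExistence_of_globalInvariantCycles hT hRE hD hX p c hc hpp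

/-- **STUB 4 ⟸ (T') + (C) + (D)** — the registered signature, VERBATIM, from the alternative
transcendence input of route `PeriodDeficiency` (`ClassicalGeometricVHS` stmt-11597 ∧
`QbarGenericIsHodgeGeneric` stmt-11595 ∧ the named fact `bku_finite_monodromyOrbit_of_isHodgeGenericIn`)
together with (C) and (D). [cite: KlinglerOtwinowskaUrbanik2023, Conj. 1.5 (a) and Thm. 1.12]
[cite: Voisin2007HodgeLoci, §3, proof of Prop. 0.7] [cite: CharlesSchnell2014Notes, Thm. 11.3.19] -/
theorem stub_qbarFibreAnchor_of_pairMovable_of_qbarGenericIsHodgeGeneric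
    (hC : Summit.HodgeConjecture.HodgeConjecture.Theses.PeriodDeficiency.ClassicalGeometricVHS)
    (hG : Summit.HodgeConjecture.HodgeConjecture.Theses.PeriodDeficiency.QbarGenericIsHodgeGeneric)
    (hB : bku_finite_monodromyOrbit_of_isHodgeGenericIn)
    (hRE : Literature.AlgebraicGeometry.FundamentalGroup.riemannExistence_qbarDescent_of_finiteIndex)
    (hD : deligne_globalInvariantCycles) :
    ∀ ⦃n : ℕ⦄ ⦃X : SchemeOver ℂ⦄, IsSmoothProjective n X →
      ∀ (p : ℕ) (c : complexBetti X (2 * p)), IsRationalClass c → IsOfHodgeType n X (2 * p) p p c →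
      ¬ (∀ ⦃𝒳 S : SchemeOver ℂ⦄ (f : 𝒳 ⟶ S) (s₁ s₀ : ComplexPoints S) (e : X ≅ fiberOver f s₁)
          (A : complexBetti 𝒳 (2 * p)),
        IsSmoothProjectiveFamily f n → IrreducibleSpace S.left → AlgebraicGeometry.Smooth S.hom →
        (∀ s : ComplexPoints S, IsRationalClass (complexBetti.map (fiberι f s) (2 * p) A) ∧
          IsOfHodgeType n (fiberOver f s) (2 * p) p p (complexBetti.map (fiberι f s) (2 * p) A)) →
        complexBetti.map e.hom (2 * p) (complexBetti.map (fiberι f s₁) (2 * p) A) = c →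
        Nonempty (X ≅ fiberOver f s₀)) →
      ∃ (𝒳 S : SchemeOver ℂ) (f : 𝒳 ⟶ S) (s₁ s₀ : ComplexPoints S) (e : X ≅ fiberOver f s₁)
        (A : complexBetti 𝒳 (2 * p)),
        IsSmoothProjectiveFamily f n ∧ IrreducibleSpace S.left ∧ AlgebraicGeometry.Smooth S.hom ∧
        (∀ s : ComplexPoints S, IsRationalClass (complexBetti.map (fiberι f s) (2 * p) A) ∧
          IsOfHodgeType n (fiberOver f s) (2 * p) p p (complexBetti.map (fiberι f s) (2 * p) A)) ∧
        complexBetti.map e.hom (2 * p) (complexBetti.map (fiberι f s₁) (2 * p) A) = c ∧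
        ∃ (K : Type) (_ : Field K) (_ : NumberField K) (σ : K →+* ℂ) (X₀ : SchemeOver K),
          Nonempty (fiberOver f s₀ ≅ (baseChangeHom σ).obj X₀) :=
  fun _ _ hX p c hc hpp _ ↦ qbarFibreAnchors_of_qbarGenericIsHodgeGeneric' hC hG hB hRE hD hX p c hc hpp

end Summit.HodgeConjecture.HodgeConjecture.Theorems.QbarFibreAnchors

end
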